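import Mathlib
import Literature.Computability.Complexity.CircuitClasses
import Literature.Computability.Complexity.Nondeterministic
import Literature.Computability.Complexity.Promise
import Literature.Computability.MetaComplexity.MCSP
import Literature.Computability.MetaComplexity.FormulaModelsAE
import HarnessLib

/-!
# Atserias–Müller 2025, Theorem 24 (general magnification for sparse NP problems, deterministic
# and one-sided probabilistic De Morgan formulas) — as a named fact (census rows R11/R12), with the
# source's promise-problem formula classes `FML[s]`, `PFML[s]`

Source: A. Atserias, M. Müller, *Simple general magnification of circuit lower bounds*,
arXiv:2503.24061 (2025) (bib key `AtseriasMuller2025`). Held text: `lit read paper:arxiv-2503.24061`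
(chunks `p0003` §1 conventions and `ε-MCSP[σ]`, `p0004` `PFML`, Thm 4, `p0005` `ε-Q`, Thms 9, 10,
`p0011` Thm 24 with proof, `p0014` Thm 32).

## The printed statements (verbatim)

Conventions (§1, p. 1): *"by a circuit (resp. formula) we mean one with inner gates labeled ¬, ∧, ∨
of fan-in at most 2 (and, resp., of fan-out at most 1); its size is the number of gates. A promise
problem is given by disjoint sets YES and NO of binary strings. It is contained in SIZE[s] (resp.
FML[s]), where `s : ℕ → ℕ`, if for all sufficiently large `n ∈ ℕ` there is a circuit (resp. formula)
`Cₙ` of size `≤ s(n)` that accepts all n-bit strings in YES and rejects all n-bit strings in NO."*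
*"for `q : ℕ → ℕ`, a problem `Q` is q-sparse if `|Q ∩ {0,1}ⁿ| ≤ q(n)` for all `n ∈ ℕ`."*
(§1.3, p. 2) *"a promise problem belongs to PFML[s], where `s : ℕ → ℕ`, if for all large enough
`n ∈ ℕ` there exists a probabilistic formula 𝐅 of size `≤ s(n)` (i.e., a random variable whose values
are formulas of size `≤ s(n)`) such that `Pr[𝐅(x)=1] = 1` for all YES instances `x` of length `n` and
`Pr[𝐅(x)=1] ≤ 1/4` for all NO instances `x` of length `n`."*
(§1.4) *"ε-Q — Instance: `x ∈ {0,1}ⁿ` for some `n ∈ ℕ`. YES: `x ∈ Q`. NO: `d_H(x,y) ≥ ε(n)·n` for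
all `y ∈ Q`"* (`d_H` = Hamming distance; `ε : ℕ → ℝ_{>0}`).

**Theorem 24** (§4.3, the explicit form of the paper's main Theorem 9): *"For all `c ∈ ℕ`, all reals
`δ, ε > 0` and `γ < δ/c` and all `2^{n^γ}`-sparse problems `Q ∈ NP`, if (a) `n^{−ε}-Q ∉
FML[n^{1+2ε+δ}]` or (b) `n^{−ε}-Q ∉ PFML[n^{2ε+δ}]`, then `NP ⊄ FML[n^c]`."*
(Theorem 9 is the `o(1)` paraphrase; Theorem 4 = the case `ε = 1`, attributed to Chen–Jin–Williams
FOCS 2019 / STOC 2020.)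

The matching lower bound of the source (its "sharpness"), **Theorem 32/10**: *"There exists `d ∈ ℕ_{>0}`
such that for all reals `0 < ε, δ ≤ 1` and all `σ : ℕ → ℝ_{≥0}` with `ℓ^d ≤ σ(ℓ) ≤ 2^{o(ℓ)}`,
`n^{−ε}-MCSP[σ] ∉ PFML[n^{2ε−δ}]`"*, is NOT typed here: it concerns the source's `MCSP[σ]`, whose
circuit-size convention (¬/∧/∨ gates, with the constant `1` available as an input gate, cf. the proof
of Lemma 22) differs from the tree's `MCSPSize` (`B₂` gates) and from De Morgan circuits without
constants by an additive `O(1)` in `σ`; since the promise problem `n^{−ε}-MCSP[σ]` is sharp in `σ` on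
BOTH sides, no rendering over tree conventions is implied by the printed statement (census rule P5).
The census records the R11 gap (threshold `n^{2ε+δ}` vs known `n^{2ε−δ}`, same one-sided model) in
prose with this caveat.

## Rendering (each choice makes the typed fact WEAKER than or equal to the printed one)

* `FML s`, `PFML₁ η s` are typed literally as classes of PROMISE PROBLEMS with the constraints imposed
  for all sufficiently long instances only (as printed) — not via `promiseLift` of a language class,
  which would additionally demand consistency at short lengths (and `ε-Q` may overlap at length `0`).
  Formulas are the tree's De Morgan formulas (`IsOver deMorganBasis`, `IsFormula`), size = `Circuit.size`
  = number of gates, exactly the source's convention (its "fan-in at most 2" also admits unary ∧/∨,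
  which never reduce size). The rejection error of `PFML` is an explicit parameter `η` (census rule:
  probabilistic classes carry their error); the source's class is `PFML₁ (fun _ => 1/4)`.
* Thresholds `n^{1+2ε+δ}`, `n^{2ε+δ}` are rounded UP (bigger classes, stronger hypotheses); the
  sparsity bound `2^{n^γ}` is rounded down (`|Q ∩ {0,1}ⁿ|` is an integer: no change); `n^{−ε}` is
  `((n : ℝ)^ε)⁻¹`.
* `NP ⊄ FML[n^c]` is `¬ ∀ L ∈ NP, ofLanguage L ∈ FML (n ↦ n^c)`; `ofLanguage_mem_FML_iff` rewrites
  membership of a LANGUAGE in `FML s` as membership in the tree-style a.e. family class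
  `FamilyAE (De Morgan ∧ formula ∧ size ≤ s n)` (gate count; the leaf-size class `FORMULAae` of
  `FormulaModelsAE.lean` is a different size measure and is not compared here).
* We add `1 ≤ c` (for `c = 0` the printed `γ < δ/c` is not meaningful; that case is implied by `c = 1`).
* HONEST FRAMING (census): `thm24` is a THRESHOLD fact (T). The lower-bound hypotheses (a)/(b) are
  recorded as `Prop`s tagged `(hypothesis)`; nothing here asserts them for any explicit `Q`.
-/

namespace Literature.Computability.MetaComplexity.AtseriasMuller2025

open scoped ENNReal
open Filter Literature.Computability.Complexity Literature.Computability.MetaComplexity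

/-! ### Sparse problems, Hamming distance, the promise problem `ε-Q` -/

/-- `Q` is **`q`-sparse**: `|Q ∩ {0,1}ⁿ| ≤ q n` for all `n` (Atserias–Müller 2025, §1.1).
[cite: AtseriasMuller2025, §1.1 (q-sparse)] -/
def IsSparse (q : ℕ → ℕ) (Q : Language Bool) : Prop :=
  ∀ n : ℕ, {x : List Bool | x ∈ Q ∧ x.length = n}.ncard ≤ q n

/-- Hamming distance of two bit strings (compared position-wise on the common prefix; used only for
strings of equal length). [folklore] -/
def hammingList (x y : List Bool) : ℕ :=
  (List.zipWith (fun a b => (a != b)) x y).count true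

/-- **`ε-Q`** (Atserias–Müller 2025, §1.4): YES = `Q`; NO = strings `x` with `d_H(x, y) ≥ ε(|x|)·|x|`
for every `y ∈ Q` of the same length. [cite: AtseriasMuller2025, §1.4 (ε-Q)] -/
def farFrom (Q : Language Bool) (ε : ℕ → ℝ) : PromiseProblem :=
  ⟨Q, {x | ∀ y ∈ Q, y.length = x.length → ε x.length * x.length ≤ (hammingList x y : ℝ)}⟩

/-! ### The source's formula classes for promise problems -/

/-- **`FML[s]`** (Atserias–Müller 2025, §1): promise problems `Π` such that for all sufficiently large
`n` some De Morgan formula with at most `s n` gates accepts every YES instance and rejects every NO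
instance of length `n` (typed with one formula per length; only lengths `≥ n₀` are constrained).
[cite: AtseriasMuller2025, §1 (FML)] -/
def FML (s : ℕ → ℕ) : Set PromiseProblem :=
  {P | ∃ C : (n : ℕ) → Circuit (Fin n), ∃ n₀ : ℕ,
    (∀ n ≥ n₀, (C n).IsOver deMorganBasis ∧ (C n).IsFormula ∧ (C n).size ≤ s n) ∧
    ∀ x : List Bool, n₀ ≤ x.length →
      (x ∈ P.yes → (C x.length).eval x.get = true) ∧ (x ∈ P.no → (C x.length).eval x.get = false)}

/-- **`PFML[s]` with explicit one-sided error `η`** (Atserias–Müller 2025, §1.3, where `η = 1/4`):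
promise problems `Π` such that for all sufficiently large `n` some DISTRIBUTION over De Morgan formulas
with at most `s n` gates accepts every YES instance of length `n` with probability `1` and every NO
instance of length `n` with probability `≤ η n`. [cite: AtseriasMuller2025, §1.3 (PFML)] -/
def PFML₁ (η : ℕ → ℝ≥0∞) (s : ℕ → ℕ) : Set PromiseProblem :=
  {P | ∃ F : (n : ℕ) → PMF (Circuit (Fin n)), ∃ n₀ : ℕ,
    (∀ n ≥ n₀, ∀ C ∈ (F n).support, C.IsOver deMorganBasis ∧ C.IsFormula ∧ C.size ≤ s n) ∧
    ∀ x : List Bool, n₀ ≤ x.length →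
      (x ∈ P.yes → (F x.length).toOuterMeasure {C | C.eval x.get = false} = 0) ∧
      (x ∈ P.no → (F x.length).toOuterMeasure {C | C.eval x.get = true} ≤ η x.length)}

/-- The source's rejection error `1/4`. [cite: AtseriasMuller2025, §1.3 (PFML)] -/
noncomputable def quarter : ℕ → ℝ≥0∞ := fun _ => 4⁻¹

/-! ### Parameters, hypotheses, conclusion -/

/-- Threshold (a): `n^{1+2ε+δ}`, rounded up. [cite: AtseriasMuller2025, Thm. 24 (parameters)] -/
noncomputable def thresholdA (ε δ : ℝ) (n : ℕ) : ℕ := ⌈(n : ℝ) ^ (1 + 2 * ε + δ)⌉₊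

/-- Threshold (b): `n^{2ε+δ}`, rounded up. [cite: AtseriasMuller2025, Thm. 24 (parameters)] -/
noncomputable def thresholdB (ε δ : ℝ) (n : ℕ) : ℕ := ⌈(n : ℝ) ^ (2 * ε + δ)⌉₊

/-- Sparsity bound `2^{n^γ}`, rounded down. [cite: AtseriasMuller2025, Thm. 24 (parameters)] -/
noncomputable def sparsity (γ : ℝ) (n : ℕ) : ℕ := ⌊(2 : ℝ) ^ ((n : ℝ) ^ γ)⌋₊

/-- The distance parameter `n^{−ε}`. [cite: AtseriasMuller2025, Thm. 24 (parameters)] -/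
noncomputable def gapParam (ε : ℝ) (n : ℕ) : ℝ := ((n : ℝ) ^ ε)⁻¹

/-- **Hypothesis (a) of Theorem 24** for a problem `Q`: `n^{−ε}-Q ∉ FML[n^{1+2ε+δ}]`. An OPEN lower
bound for every explicit sparse `Q` of interest; recorded, not asserted.
[cite: AtseriasMuller2025, Thm. 24 (hypothesis)] -/
def HypothesisA (Q : Language Bool) (ε δ : ℝ) : Prop :=
  farFrom Q (gapParam ε) ∉ FML (thresholdA ε δ)

/-- **Hypothesis (b) of Theorem 24** for a problem `Q`: `n^{−ε}-Q ∉ PFML[n^{2ε+δ}]` (one-sided error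
`1/4`). OPEN for every explicit sparse `Q` of interest; recorded, not asserted.
[cite: AtseriasMuller2025, Thm. 24 (hypothesis)] -/
def HypothesisB (Q : Language Bool) (ε δ : ℝ) : Prop :=
  farFrom Q (gapParam ε) ∉ PFML₁ quarter (thresholdB ε δ)

/-- **`NP ⊄ FML[n^c]`** in the source's sense (languages as promise problems with trivial promise).
[cite: AtseriasMuller2025, Thm. 24 (conclusion)] -/
def NPNotInFML (c : ℕ) : Prop :=
  ¬ ∀ L ∈ Nondeterministic.NP, PromiseProblem.ofLanguage L ∈ FML fun n => n ^ c

/-! ### The named fact -/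

/-- **Atserias–Müller 2025, Theorem 24 (general magnification)** as a named fact: *"For all c ∈ ℕ,
all reals δ, ε > 0 and γ < δ/c and all 2^{n^γ}-sparse problems Q ∈ NP, if (a) n^{−ε}-Q ∉
FML[n^{1+2ε+δ}] or (b) n^{−ε}-Q ∉ PFML[n^{2ε+δ}], then NP ⊄ FML[n^c]."* (`1 ≤ c` added; renderings in
the module docstring.) Proof in the source: §4 (distinguishers, the kernel `K(Q,D,r) ∈ NP`,
Lemma 22, p. 9–10). Users take `(h : thm24)`. [cite: AtseriasMuller2025, Thm. 24] -/
def thm24 : Prop :=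
  ∀ (c : ℕ) (δ ε γ : ℝ), 1 ≤ c → 0 < δ → 0 < ε → γ < δ / c →
    ∀ Q : Language Bool, Q ∈ Nondeterministic.NP → IsSparse (sparsity γ) Q →
      (HypothesisA Q ε δ ∨ HypothesisB Q ε δ) → NPNotInFML c

/-- **Typed census gap (row R11/R12)**: for some `ε, δ > 0` and every `c ≥ 1`, some `2^{n^γ}`-sparse
`Q ∈ NP` with `γ < δ/c` beats threshold (a) or (b). This is what a consumer of `thm24` must supply
to conclude `NP ⊄ FML[n^c]` for every `c`. OPEN. [cite: AtseriasMuller2025, Thm. 24 (hypothesis)] -/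
def MagnificationPremise : Prop :=
  ∃ ε : ℝ, 0 < ε ∧ ∃ δ : ℝ, 0 < δ ∧ ∀ c : ℕ, 1 ≤ c → ∃ γ : ℝ, γ < δ / c ∧
    ∃ Q : Language Bool, Q ∈ Nondeterministic.NP ∧ IsSparse (sparsity γ) Q ∧
      (HypothesisA Q ε δ ∨ HypothesisB Q ε δ)

/-- **Consequence shape**: the fact plus the (open) premise give `NP ⊄ FML[n^c]` for every `c ≥ 1`.
[cite: AtseriasMuller2025, Thm. 24] -/
theorem npNotInFML_of_premise (h : thm24) (hp : MagnificationPremise) :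
    ∀ c : ℕ, 1 ≤ c → NPNotInFML c := by
  intro c hc
  obtain ⟨ε, hε, δ, hδ, hall⟩ := hp
  obtain ⟨γ, hγ, Q, hQ, hsp, hyp⟩ := hall c hc
  exact h c δ ε γ hc hδ hε hγ Q hQ hsp hyp

/-! ### API: sanity of the definitions -/

/-- `d_H(x, x) = 0`. [folklore] -/
theorem hammingList_self (x : List Bool) : hammingList x x = 0 := by
  induction x with
  | nil => rfl
  | cons a t ih =>
    unfold hammingList at ih ⊢
    simpa [List.zipWith] using ih

/-- A YES instance `x` of `ε-Q` is not a NO instance as soon as `ε(|x|)·|x| > 0` (it is at distance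
`0` from itself). In particular `n^{−ε}-Q` is a genuine promise problem at every positive length.
[folklore] -/
theorem farFrom_yes_not_no {Q : Language Bool} {ε : ℕ → ℝ} {x : List Bool}
    (hpos : 0 < ε x.length * x.length) (hx : x ∈ (farFrom Q ε).yes) : x ∉ (farFrom Q ε).no := by
  intro hno
  have h := hno x hx rfl
  rw [hammingList_self] at h
  push_cast at h
  linarith

/-- The distance parameter `n^{−ε}·n = n^{1−ε}` is positive at positive lengths. [folklore] -/
theorem gapParam_mul_pos (ε : ℝ) {n : ℕ} (hn : 0 < n) : 0 < gapParam ε n * n := by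
  unfold gapParam
  have hn' : (0 : ℝ) < n := by exact_mod_cast hn
  exact mul_pos (inv_pos.2 (Real.rpow_pos_of_pos hn' ε)) hn'

/-- `FML[s] ⊆ PFML_η[s]` for every error `η` (a formula is a point-mass distribution). [folklore] -/
theorem FML_subset_PFML₁ (η : ℕ → ℝ≥0∞) (s : ℕ → ℕ) : FML s ⊆ PFML₁ η s := by
  rintro P ⟨C, n₀, hC, hx⟩
  refine ⟨fun n => PMF.pure (C n), n₀, fun n hn D hD => ?_, fun x hxn => ⟨fun hy => ?_, fun hno => ?_⟩⟩
  · rw [PMF.support_pure, Set.mem_singleton_iff] at hD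
    subst hD
    exact hC n hn
  · rw [PMF.toOuterMeasure_pure_apply, if_neg]
    simpa using (hx x hxn).1 hy
  · rw [PMF.toOuterMeasure_pure_apply, if_neg]
    · exact bot_le
    · simpa using (hx x hxn).2 hno

/-- `FML` is monotone in the (eventual) size bound. [folklore] -/
theorem FML_mono {s s' : ℕ → ℕ} (h : ∃ n₁ : ℕ, ∀ n ≥ n₁, s n ≤ s' n) : FML s ⊆ FML s' := by
  rintro P ⟨C, n₀, hC, hx⟩
  obtain ⟨n₁, hn₁⟩ := h
  refine ⟨C, max n₀ n₁, fun n hn => ?_, fun x hxn => hx x (le_of_max_le_left hxn)⟩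
  obtain ⟨h1, h2, h3⟩ := hC n (le_of_max_le_left hn)
  exact ⟨h1, h2, h3.trans (hn₁ n (le_of_max_le_right hn))⟩

/-- `PFML₁` is monotone in the error and in the (eventual) size bound. [folklore] -/
theorem PFML₁_mono {η η' : ℕ → ℝ≥0∞} {s s' : ℕ → ℕ} (hη : ∀ n, η n ≤ η' n)
    (h : ∃ n₁ : ℕ, ∀ n ≥ n₁, s n ≤ s' n) : PFML₁ η s ⊆ PFML₁ η' s' := by
  rintro P ⟨F, n₀, hF, hx⟩
  obtain ⟨n₁, hn₁⟩ := h
  refine ⟨F, max n₀ n₁, fun n hn C hC => ?_, fun x hxn =>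
    ⟨fun hy => (hx x (le_of_max_le_left hxn)).1 hy,
     fun hno => ((hx x (le_of_max_le_left hxn)).2 hno).trans (hη _)⟩⟩
  obtain ⟨h1, h2, h3⟩ := hF n (le_of_max_le_left hn) C hC
  exact ⟨h1, h2, h3.trans (hn₁ n (le_of_max_le_right hn))⟩

/-- A promise problem with FEWER NO instances is easier: shrinking the NO side preserves membership
in `PFML₁ η s`. [folklore] -/
theorem PFML₁_anti_no {η : ℕ → ℝ≥0∞} {s : ℕ → ℕ} {P P' : PromiseProblem} (hyes : P'.yes ≤ P.yes)
    (hno : P'.no ≤ P.no) (h : P ∈ PFML₁ η s) : P' ∈ PFML₁ η s := by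
  obtain ⟨F, n₀, hF, hx⟩ := h
  exact ⟨F, n₀, hF, fun x hxn =>
    ⟨fun hy => (hx x hxn).1 (hyes hy), fun hn => (hx x hxn).2 (hno hn)⟩⟩

/-- Hence hypothesis (b) is monotone in the distance parameter: for `ε ≤ ε'` the NO side of
`n^{−ε'}-Q` is larger, so a lower bound for `n^{−ε}-Q` implies the one for `n^{−ε'}-Q` at the same
size bound. [folklore] -/
theorem farFrom_no_mono {Q : Language Bool} {ε ε' : ℕ → ℝ} (h : ∀ n, ε' n ≤ ε n) :
    (farFrom Q ε).no ≤ (farFrom Q ε').no := by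
  intro x hx y hy hlen
  have hxn : (0 : ℝ) ≤ x.length := Nat.cast_nonneg _
  exact le_trans (mul_le_mul_of_nonneg_right (h _) hxn) (hx y hy hlen)

/-- **A language is in `FML[s]` iff it has an almost-everywhere De Morgan formula family with at most
`s n` gates** in the sense of `FormulaModelsAE.FamilyAE` (the family must decide `L` at every length;
below `n₀` use any circuit computing the slice, `exists_circuit_eval_eq`). [folklore] -/
theorem ofLanguage_mem_FML_iff (L : Language Bool) (s : ℕ → ℕ) :
    PromiseProblem.ofLanguage L ∈ FML s ↔
      L ∈ FamilyAE fun n C => C.IsOver deMorganBasis ∧ C.IsFormula ∧ C.size ≤ s n := by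
  constructor
  · rintro ⟨C, n₀, hC, hx⟩
    choose D hDB hD using fun n => exists_circuit_eval_eq n fun v => L.boolIndicator (List.ofFn v)
    refine ⟨fun n => if n < n₀ then D n else C n, ⟨n₀, fun n hn => ?_⟩, fun x => ?_⟩
    · have hnm : ¬ n < n₀ := not_lt.2 hn
      simp only [hnm, if_false]
      exact hC n hn
    · by_cases hxl : x.length < n₀
      · simp only [hxl, if_true, hD, List.ofFn_get]
      · simp only [hxl, if_false]
        have hx' := hx x (not_lt.1 hxl)
        by_cases hmem : x ∈ L
        · rw [hx'.1 hmem]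
          exact ((Set.mem_iff_boolIndicator _ _).1 hmem).symm
        · have hno : x ∈ (PromiseProblem.ofLanguage L).no := hmem
          rw [hx'.2 hno]
          exact ((Set.notMem_iff_boolIndicator _ _).1 hmem).symm
  · rintro ⟨C, ⟨n₀, hn₀⟩, hdec⟩
    refine ⟨C, n₀, hn₀, fun x _ => ⟨fun hy => ?_, fun hno => ?_⟩⟩
    · rw [hdec x]
      exact (Set.mem_iff_boolIndicator _ _).1 (show x ∈ L from hy)
    · rw [hdec x]
      exact (Set.notMem_iff_boolIndicator _ _).1 (show x ∉ L from hno)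

/-- **`FML[s]` contains a nontrivial language for every `s`** (`headLang`, decided by the `0`-gate
formula `x₀` at positive lengths): the classes in the conclusion of `thm24` are inhabited. [folklore] -/
theorem ofLanguage_headLang_mem_FML (s : ℕ → ℕ) : PromiseProblem.ofLanguage headLang ∈ FML s := by
  rw [ofLanguage_mem_FML_iff]
  exact headLang_mem_FamilyAE ⟨0, fun n _ =>
    ⟨Circuit.isOver_input deMorganBasis 0, (Circuit.isFormula_input (0 : Fin (n + 1))).1, by simp⟩⟩

/-- The threshold classes of hypotheses (a)/(b) are inhabited (for any `ε, δ`, error `η`). [folklore] -/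
theorem ofLanguage_headLang_mem_PFML₁ (η : ℕ → ℝ≥0∞) (s : ℕ → ℕ) :
    PromiseProblem.ofLanguage headLang ∈ PFML₁ η s :=
  FML_subset_PFML₁ η s (ofLanguage_headLang_mem_FML s)

end Literature.Computability.MetaComplexity.AtseriasMuller2025
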